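import Summits.QuantumFields.YangMills.Theorems.BalabanUVNodesN15CovariantLandauLetterFromFlatLeibniz
import HarnessLib

/-!
# Route «BalabanUVNodes», node N15 = NE2, road (c) — PROGRAMME (P-S), XLIV: THE ONE-GRID ROW OF `S(T)⁻¹ = (Q′_TG′(T)²Q′_Tᵀ)⁻¹` FROM THE FOUR FLAT ROWS, THE COVARIANT GRADIENT-DIFFERENCE ROW AND
# THE TRANSPORTER LETTERS — n15-c∕217's internal steps 1–5 EXPORTED (the input `hSi`∕`hSi′` of n15-c∕243) (dag-n15-c g25, n15-c∕251)

Cell `pub-ymgap`, seat `pub-ymgap-dag-n15-c` (generation g25; R134 (a), s1; HUMAN RULING D-0062; chair R424 venue).  `bears_on: R4∕N15 · K3⁸ SpineGivenEndpointR13SepCoPHV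
(stmt-QuantumFields-27366)`; filed `--supports stmt-QuantumFields-27366 --as helper` — COUNT-NEUTRAL.  One theorem; 0 `sorry`.  Imports BY NAME n15-c∕217 (`cA0 cK1 cPG0 cM2 cB0 landauSmallConst`,
`hasMaj_cGreen_of_flat`, `hasMaj_cGreen_sub_of_flat`, `hasMaj_cM_of∕_sub_of`, `hasMaj_cSop_sub_of`, `hasMaj_cSop_inv_of_flat`).  The proof is n15-c∕217's own, verbatim up to its step 5, with the
intermediate row `S(T)⁻¹ ≤ 2C_S·n^{d+1}·e^{−(3δ/4)d}` returned instead of consumed.  Nothing in the tree is modified.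

WHY.  n15-c∕243 `hasMaj_idef_cvNVr_of_rows` displays the one-grid rows of `S(T)⁻¹` on both grids (`hSi`, `hSi′`); n15-c∕217 derives exactly this row inside its proof but does not export it.
* ★★ `hasMaj_cSop_inv_of_flat_gradDiff`.

HONEST FRAMING ∕ LIMITS.  Bookkeeping (n15-c∕217's steps); the flat rows and the gradient-difference row are HYPOTHESES here (theorems by n15-c∕220∕222b∕230); MODEL carriers; NOT
[Balaban1985BackgroundPropagators] Thm 3.4 ∕ [Balaban1984PropagatorsII] Prop. 2.3 as printed; NE2⁺ NOT PRINTED; N15 of record untouched (DISCHARGED AS CONSUMED, p687738); counts UNMOVED (typed 28∕28 ·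
discharged 8∕27); one finite 𝕋⁴ at fixed ε per index — NOT infinite volume ∕ OS ∕ mass gap ∕ Clay.  Restate-immune (no Theses import).
-/

noncomputable section

open scoped BigOperators Matrix
open Finset

namespace Summit.QuantumFields.YangMills.BalabanUVNodes.N15.CovLandau

open Literature.MathematicalPhysics.QuantumFieldTheory.Balaban1983to89
open Literature.MathematicalPhysics.QuantumFieldTheory.Balaban1983to89.B5Prop11Plancherel (Tor fine)
open Literature.MathematicalPhysics.QuantumFieldTheory.Balaban1983to89.B11SectG (BlockNorm HasMaj RowSum)
open Literature.MathematicalPhysics.QuantumFieldTheory.Balaban1983to89.B6UnitTorusCarrier (unitTorusGeo rowSum_unitTorusGeo unitTorusGeo_dist_nonneg)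
open Literature.MathematicalPhysics.QuantumFieldTheory.King1986.Torus (blockOf tdistT)
open Summit.QuantumFields.YangMills.BalabanUVNodes.N15.MatrixSpecies (liftBlk)
open Summit.QuantumFields.YangMills.BalabanUVNodes.N15.CovAvg (cvaStair cvaStair_one rows_le_of_rows_sub_one cols_le_of_cols_sub_one)

variable {d : ℕ}

section Main

variable (M : Fin (d + 1) → ℕ) [∀ μ, NeZero (M μ)] (n : ℕ) [NeZero n] {ι : Type} [Fintype ι] [DecidableEq ι] (L k : ℕ)

set_option maxHeartbeats 1000000 in
/-- ★★ **THE ONE-GRID ROW OF `S(T)⁻¹`** from the four flat rows, the covariant gradient-difference row `D_TG′(T) − ∂G′(1)` (constant `P₀·r`) and the letters: `S(T)⁻¹ ≤ 2C_S·n^{d+1}·e^{−(3δ/4)d}`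
below n15-c∕217's smallness threshold (n15-c∕217, steps 1–5, exported). [cite: Balaban1984PropagatorsII, Prop. 2.3 pp.230–231 (the `(QG²Q*)⁻¹` row: shape); Balaban1985BackgroundPropagators, (3.25) p.394, Thm 3.4 p.400 (mechanism)] -/
theorem hasMaj_cSop_inv_of_flat_gradDiff {T : Fin (d + 1) → Tor (fine n M) → Matrix ι ι ℝ} (hT : ∀ ν x, IsUnit (T ν x)) {a : ℝ} (ha : 0 < a)
    {δ CG CA CD CS P0 Cρ Cσ α r ρ σ : ℝ} (hδ : 0 < δ) (hCG : 0 ≤ CG) (hCA : 0 ≤ CA) (hCD : 0 ≤ CD) (hCS : 0 ≤ CS) (hP0 : 0 ≤ P0) (hCρ : 0 ≤ Cρ) (hCσ : 0 ≤ Cσ) (hα : 0 ≤ α)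
    (hr0 : 0 ≤ r) (hr1 : r ≤ 1) (hρ0 : 0 ≤ ρ) (hσ0 : 0 ≤ σ) (haα : |a| * ((n : ℝ) ^ (d + 1))⁻¹ ≤ α)
    (hρr : ∀ ν x i, ∑ j, |(T ν x - (fun (_ : Fin (d + 1)) (_ : Tor (fine n M)) => (1 : Matrix ι ι ℝ)) ν x) i j| ≤ ρ)
    (hρc : ∀ ν x j, ∑ i, |(T ν x - (fun (_ : Fin (d + 1)) (_ : Tor (fine n M)) => (1 : Matrix ι ι ℝ)) ν x) i j| ≤ ρ)
    (hσr : ∀ y a' i, ∑ j, |(cvaStair M n (fun μ b => T μ b.1) y a' 0 - cvaStair M n (fun μ b => (fun (_ : Fin (d + 1)) (_ : Tor (fine n M)) => (1 : Matrix ι ι ℝ)) μ b.1) y a' 0) i j| ≤ σ)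
    (hσc : ∀ y a' j, ∑ i, |(cvaStair M n (fun μ b => T μ b.1) y a' 0 - cvaStair M n (fun μ b => (fun (_ : Fin (d + 1)) (_ : Tor (fine n M)) => (1 : Matrix ι ι ℝ)) μ b.1) y a' 0) i j| ≤ σ)
    (hnρ : (n : ℝ) * ρ ≤ Cρ * r) (hσle : σ ≤ Cσ * r)
    (hG1 : HasMaj (BlockNorm.ofBlocks (unitTorusGeo L k M) (liftBlk (blockOf n M) ι)) (BlockNorm.ofBlocks (unitTorusGeo L k M) (liftBlk (blockOf n M) ι)) (Matrix.mulVecLin (cGreen M n (fun (_ : Fin (d + 1)) (_ : Tor (fine n M)) => (1 : Matrix ι ι ℝ)) a)) (fun y y' => CG * Real.exp (-(δ * tdistT M y y'))))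
    (hA1 : HasMaj (BlockNorm.ofBlocks (unitTorusGeo L k M) (liftBlk (fun b : Tor (fine n M) × Fin (d + 1) => blockOf n M b.1) ι)) (BlockNorm.ofBlocks (unitTorusGeo L k M) (liftBlk (blockOf n M) ι)) (Matrix.mulVecLin (cGreen M n (fun (_ : Fin (d + 1)) (_ : Tor (fine n M)) => (1 : Matrix ι ι ℝ)) a * (cgrad M n (fun (_ : Fin (d + 1)) (_ : Tor (fine n M)) => (1 : Matrix ι ι ℝ)))ᵀ)) (fun y y' => CA * Real.exp (-(δ * tdistT M y y'))))
    (hD1 : HasMaj (BlockNorm.ofBlocks (unitTorusGeo L k M) (liftBlk (blockOf n M) ι)) (BlockNorm.ofBlocks (unitTorusGeo L k M) (liftBlk (fun b : Tor (fine n M) × Fin (d + 1) => blockOf n M b.1) ι)) (Matrix.mulVecLin (cgrad M n (fun (_ : Fin (d + 1)) (_ : Tor (fine n M)) => (1 : Matrix ι ι ℝ)) * cGreen M n (fun (_ : Fin (d + 1)) (_ : Tor (fine n M)) => (1 : Matrix ι ι ℝ)) a)) (fun y y' => CD * Real.exp (-(δ * tdistT M y y'))))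
    (hS1 : HasMaj (BlockNorm.ofBlocks (unitTorusGeo L k M) (liftBlk (fun y : Tor M => y) ι)) (BlockNorm.ofBlocks (unitTorusGeo L k M) (liftBlk (fun y : Tor M => y) ι)) (Matrix.mulVecLin (cSop M n (fun (_ : Fin (d + 1)) (_ : Tor (fine n M)) => (1 : Matrix ι ι ℝ)) a)⁻¹) (fun y y' => CS * (n : ℝ) ^ (d + 1) * Real.exp (-(δ * tdistT M y y'))))
    (hδD : HasMaj (BlockNorm.ofBlocks (unitTorusGeo L k M) (liftBlk (blockOf n M) ι)) (BlockNorm.ofBlocks (unitTorusGeo L k M) (liftBlk (fun b : Tor (fine n M) × Fin (d + 1) => blockOf n M b.1) ι)) (Matrix.mulVecLin (cgrad M n T * cGreen M n T a - cgrad M n (fun (_ : Fin (d + 1)) (_ : Tor (fine n M)) => (1 : Matrix ι ι ℝ)) * cGreen M n (fun (_ : Fin (d + 1)) (_ : Tor (fine n M)) => (1 : Matrix ι ι ℝ)) a)) (fun y y' => P0 * r * Real.exp (-(δ * tdistT M y y'))))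
    (hsmall : landauSmallConst (d + 1) (Fintype.card ι) CG CA CD CS P0 Cρ Cσ α (B4Sect5Proof.latticeConst (d + 1) (δ / 16)) δ * r ≤ 1) :
    HasMaj (BlockNorm.ofBlocks (unitTorusGeo L k M) (liftBlk (fun y : Tor M => y) ι)) (BlockNorm.ofBlocks (unitTorusGeo L k M) (liftBlk (fun y : Tor M => y) ι)) (Matrix.mulVecLin (cSop M n T a)⁻¹) (fun y y' => (2 * CS) * (n : ℝ) ^ (d + 1) * Real.exp (-((3 * δ / 4) * tdistT M y y'))) := by
  -- constants (opaque names with defining equations; rate facts first, while the context is small)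
  have hn : (0 : ℝ) < (n : ℝ) ^ (d + 1) := pow_pos (Nat.cast_pos.mpr (Nat.pos_of_ne_zero (NeZero.ne n))) _
  have hd := unitTorusGeo_dist_nonneg L k M
  set s : ℝ := δ / 16 with hsdef
  have hs : 0 < s := by positivity
  have hr2s : 2 * s ≤ δ := by linarith
  have hr3 : s ≤ δ - 2 * s := by linarith
  have hr4 : δ - 2 * s ≤ δ := by linarith
  have hr5 : δ - 2 * s + 2 * s ≤ δ := by linarith
  have hr6 : 0 ≤ δ - 2 * s := by linarith
  have hr7 : δ - 2 * s + s ≤ δ := by linarith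
  have hr8 : 3 * δ / 4 ≤ δ - 2 * s - 2 * s := by linarith
  have hr9 : 3 * δ / 4 ≤ δ := by linarith
  have hr10 : 3 * δ / 4 ≤ δ - 2 * s := by linarith
  have hr11 : 3 * δ / 8 ≤ 3 * δ / 4 / 2 := by linarith
  have hr12 : 0 < 3 * δ / 4 := by positivity
  have hr13 : 2 * s ≤ δ - 2 * s := by linarith
  set c : ℝ := B4Sect5Proof.latticeConst (d + 1) s with hcdef
  have hrow : RowSum (unitTorusGeo L k M) s c := rowSum_unitTorusGeo L k M hs
  have hc : 0 ≤ c := B4Sect5Proof.latticeConst_nonneg (d + 1) hs.le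
  have hD : (0 : ℝ) ≤ ((d : ℝ) + 1) := by positivity
  have hI : (0 : ℝ) ≤ (Fintype.card ι : ℝ) := Nat.cast_nonneg _
  obtain ⟨A0, hA0def⟩ : ∃ x : ℝ, x = cA0 ((d : ℝ) + 1) CG CD P0 Cρ c δ := ⟨_, rfl⟩
  have hA0 : 0 ≤ A0 := by rw [hA0def]; unfold cA0; positivity
  obtain ⟨K1, hK1def⟩ : ∃ x : ℝ, x = cK1 CG CA Cρ Cσ α c δ := ⟨_, rfl⟩
  have hK1 : 0 ≤ K1 := by rw [hK1def]; unfold cK1; positivity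
  obtain ⟨PG0, hPG0def⟩ : ∃ x : ℝ, x = cPG0 ((d : ℝ) + 1) CG CA CD P0 Cρ Cσ α c δ := ⟨_, rfl⟩
  have hPG0 : 0 ≤ PG0 := by rw [hPG0def]; unfold cPG0 cA0; positivity
  obtain ⟨CM, hCMdef⟩ : ∃ x : ℝ, x = cM2 ((d : ℝ) + 1) CG CD P0 Cρ c δ := ⟨_, rfl⟩
  have hCM : CM = 2 * A0 + CG := by rw [hCMdef, hA0def]; rfl
  have hCM0 : 0 ≤ CM := by rw [hCM]; positivity
  obtain ⟨B0, hB0def⟩ : ∃ x : ℝ, x = cB0 ((d : ℝ) + 1) (Fintype.card ι : ℝ) CG CA CD P0 Cρ Cσ α c δ := ⟨_, rfl⟩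
  have hB0eq : B0 = (Fintype.card ι : ℝ) * c * CM * 3 * (2 * PG0 + CM * Cσ) := by rw [hB0def, hCMdef, hPG0def]; rfl
  have hB0 : 0 ≤ B0 := by rw [hB0eq]; positivity
  -- the smallness consequences
  have hsm : landauSmallConst ((d : ℝ) + 1) (Fintype.card ι : ℝ) CG CA CD CS P0 Cρ Cσ α c δ = 2 * (K1 * c + CS * B0 * c * c) + Cρ + Cσ + 1 := by rw [hK1def, hB0def]; rfl
  have hsmall' : (2 * (K1 * c + CS * B0 * c * c) + Cρ + Cσ + 1) * r ≤ 1 := by rw [← hsm]; exact hsmall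
  have hKc0 : 0 ≤ K1 * c := mul_nonneg hK1 hc
  have hSB0 : 0 ≤ CS * B0 * c * c := by positivity
  have hsum0 : 0 ≤ 2 * (K1 * c + CS * B0 * c * c) + Cρ + Cσ + 1 := by positivity
  have hle1 : Cσ * r ≤ 1 :=
    (mul_le_mul_of_nonneg_right (by linarith only [hKc0, hSB0, hCρ] : Cσ ≤ 2 * (K1 * c + CS * B0 * c * c) + Cρ + Cσ + 1) hr0).trans hsmall'
  have hle2 : Cρ * r ≤ 1 :=
    (mul_le_mul_of_nonneg_right (by linarith only [hKc0, hSB0, hCσ] : Cρ ≤ 2 * (K1 * c + CS * B0 * c * c) + Cρ + Cσ + 1) hr0).trans hsmall'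
  have hle3 : (2 * (K1 * c)) * r ≤ 1 :=
    (mul_le_mul_of_nonneg_right (by linarith only [hSB0, hCσ, hCρ] : 2 * (K1 * c) ≤ 2 * (K1 * c + CS * B0 * c * c) + Cρ + Cσ + 1) hr0).trans hsmall'
  have hle4 : (2 * (CS * B0 * c * c)) * r ≤ 1 :=
    (mul_le_mul_of_nonneg_right (by linarith only [hKc0, hCσ, hCρ] : 2 * (CS * B0 * c * c) ≤ 2 * (K1 * c + CS * B0 * c * c) + Cρ + Cσ + 1) hr0).trans hsmall'
  have hσ1 : σ ≤ 1 := hσle.trans hle1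
  have hnρ1 : (n : ℝ) * ρ ≤ 1 := hnρ.trans hle2
  have hq1 : K1 * c * r ≤ 1 / 2 := by linarith only [hle3]
  have hq2 : CS * B0 * c * c * r ≤ 1 / 2 := by linarith only [hle4]
  -- the staircase sums `τ := 1 + σ ≤ 2`
  have e1 : ∀ (y : Tor M) (a' : Fin (d + 1) → Fin n), cvaStair M n (fun μ (b : Tor (fine n M) × Fin (d + 1)) => (fun (_ : Fin (d + 1)) (_ : Tor (fine n M)) => (1 : Matrix ι ι ℝ)) μ b.1) y a' 0 = 1 := fun y a' => cvaStair_one M n y a' 0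
  have hτr : ∀ y a' i, ∑ j, |cvaStair M n (fun μ b => T μ b.1) y a' 0 i j| ≤ 1 + σ := fun y a' i =>
    rows_le_of_rows_sub_one (A := cvaStair M n (fun μ b => T μ b.1) y a' 0) (fun i' => by have h := hσr y a' i'; rwa [e1] at h) i
  have hτc : ∀ y a' i, ∑ j, |cvaStair M n (fun μ b => T μ b.1) y a' 0 j i| ≤ 1 + σ := fun y a' i =>
    cols_le_of_cols_sub_one (A := cvaStair M n (fun μ b => T μ b.1) y a' 0) (fun j' => by have h := hσc y a' j'; rwa [e1] at h) i
  have hτ0 : (0 : ℝ) ≤ 1 + σ := by positivity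
  have hτ2 : 1 + σ ≤ 2 := by linarith only [hσ1]
  -- STEP 1 (n15-c∕215): the row of `G′(T)` at rate `δ − 2s`
  have hθK : CA * ((n : ℝ) * ρ * Real.exp δ) * c + |a| * (((n : ℝ) ^ (d + 1))⁻¹ * CG * (σ * (1 + σ) + σ)) ≤ K1 * r := by
    have h1 : CA * ((n : ℝ) * ρ * Real.exp δ) * c ≤ CA * (Cρ * r * Real.exp δ) * c :=
      mul_le_mul_of_nonneg_right (mul_le_mul_of_nonneg_left (mul_le_mul_of_nonneg_right hnρ (Real.exp_pos _).le) hCA) hc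
    have h3 : σ * (1 + σ) + σ ≤ 3 * (Cσ * r) := by
      have : σ * (1 + σ) ≤ σ * 2 := mul_le_mul_of_nonneg_left hτ2 hσ0
      linarith only [this, hσle]
    have h2 : |a| * (((n : ℝ) ^ (d + 1))⁻¹ * CG * (σ * (1 + σ) + σ)) ≤ α * (CG * (3 * (Cσ * r))) := by
      calc |a| * (((n : ℝ) ^ (d + 1))⁻¹ * CG * (σ * (1 + σ) + σ)) = (|a| * ((n : ℝ) ^ (d + 1))⁻¹) * (CG * (σ * (1 + σ) + σ)) := by ring
        _ ≤ α * (CG * (3 * (Cσ * r))) := mul_le_mul haα (mul_le_mul_of_nonneg_left h3 hCG) (by positivity) hα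
    calc _ ≤ CA * (Cρ * r * Real.exp δ) * c + α * (CG * (3 * (Cσ * r))) := add_le_add h1 h2
      _ = K1 * r := by rw [hK1def]; unfold cK1; ring
  have hθKc : (CA * ((n : ℝ) * ρ * Real.exp δ) * c + |a| * (((n : ℝ) ^ (d + 1))⁻¹ * CG * (σ * (1 + σ) + σ))) * c ≤ 1 / 2 :=
    (mul_le_mul_of_nonneg_right hθK hc).trans (by linarith only [hq1, show K1 * r * c = K1 * c * r by ring])
  have hqK : (CA * ((n : ℝ) * ρ * Real.exp δ) * c + |a| * (((n : ℝ) ^ (d + 1))⁻¹ * CG * (σ * (1 + σ) + σ))) * c < 1 := by linarith only [hθKc]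
  have hGT0 := hasMaj_cGreen_of_flat M n L k hT ha hs hr2s hrow hc hCG hCA hCD (by positivity : 0 ≤ P0 * r) hρ0 hσ0 hτ0 hρr hρc hσr hσc hτr hG1 hA1 hD1 hδD hqK
  have hAle : CG + CG * ((n : ℝ) * (((d + 1 : ℕ) : ℝ) * ρ) * Real.exp δ) * (CD + P0 * r) * c * c ≤ A0 := by
    have h1 : (n : ℝ) * (((d + 1 : ℕ) : ℝ) * ρ) ≤ ((d : ℝ) + 1) * Cρ := by
      calc (n : ℝ) * (((d + 1 : ℕ) : ℝ) * ρ) = ((d : ℝ) + 1) * ((n : ℝ) * ρ) := by push_cast; ring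
        _ ≤ ((d : ℝ) + 1) * (Cρ * r) := mul_le_mul_of_nonneg_left hnρ hD
        _ ≤ ((d : ℝ) + 1) * Cρ := mul_le_mul_of_nonneg_left (mul_le_of_le_one_right hCρ hr1) hD
    have h2 : CD + P0 * r ≤ CD + P0 := add_le_add le_rfl (mul_le_of_le_one_right hP0 hr1)
    have t1 : (n : ℝ) * (((d + 1 : ℕ) : ℝ) * ρ) * Real.exp δ ≤ ((d : ℝ) + 1) * Cρ * Real.exp δ := mul_le_mul_of_nonneg_right h1 (Real.exp_pos _).le
    have t2 : CG * ((n : ℝ) * (((d + 1 : ℕ) : ℝ) * ρ) * Real.exp δ) * (CD + P0 * r) ≤ CG * (((d : ℝ) + 1) * Cρ * Real.exp δ) * (CD + P0) :=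
      mul_le_mul (mul_le_mul_of_nonneg_left t1 hCG) h2 (by positivity) (by positivity)
    have t3 := mul_le_mul_of_nonneg_right (mul_le_mul_of_nonneg_right t2 hc) hc
    calc _ ≤ CG + CG * (((d : ℝ) + 1) * Cρ * Real.exp δ) * (CD + P0) * c * c := add_le_add le_rfl t3
      _ = A0 := by rw [hA0def]; unfold cA0; ring
  have hinvK : (1 - (CA * ((n : ℝ) * ρ * Real.exp δ) * c + |a| * (((n : ℝ) ^ (d + 1))⁻¹ * CG * (σ * (1 + σ) + σ))) * c)⁻¹ ≤ 2 := by
    calc _ ≤ (1 / 2 : ℝ)⁻¹ := inv_anti₀ (by norm_num) (by linarith only [hθKc])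
      _ = 2 := by norm_num
  have hGT : HasMaj (BlockNorm.ofBlocks (unitTorusGeo L k M) (liftBlk (blockOf n M) ι)) (BlockNorm.ofBlocks (unitTorusGeo L k M) (liftBlk (blockOf n M) ι)) (Matrix.mulVecLin (cGreen M n T a)) (fun y y' => (2 * A0) * Real.exp (-((δ - 2 * s) * tdistT M y y'))) := by
    refine hGT0.mono fun y y' => mul_le_mul_of_nonneg_right ?_ (Real.exp_nonneg _)
    calc _ ≤ A0 * 2 := mul_le_mul hAle hinvK (inv_nonneg.mpr (by linarith only [hθKc])) hA0
      _ = 2 * A0 := mul_comm _ _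
  -- STEP 2 (n15-c∕216 §1): the row of `G′(T) − G′(1)` at rate `δ − 2s`
  have hδG0 := hasMaj_cGreen_sub_of_flat M n L k hT ha (δT := δ - 2 * s) hs hr6 hr5 hrow hc hCG hCA hCD (by positivity : 0 ≤ P0 * r)
    (by positivity : 0 ≤ 2 * A0) hρ0 hσ0 hτ0 hρr hρc hσr hσc hτr hG1 hA1 hD1 hδD hGT
  obtain ⟨PG, hPGdef⟩ : ∃ x : ℝ, x = CG * ((n : ℝ) * (((d + 1 : ℕ) : ℝ) * ρ) * Real.exp δ) * c * (CD + P0 * r) * c + CA * ((n : ℝ) * ρ * Real.exp (δ - 2 * s + s) * (2 * A0) * c) * c +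
      |a| * (CG * (((n : ℝ) ^ (d + 1))⁻¹ * σ * ((1 + σ) * (2 * A0))) * c) + |a| * (CG * (((n : ℝ) ^ (d + 1))⁻¹ * 1 * (σ * (2 * A0))) * c) := ⟨_, rfl⟩
  have hPG : 0 ≤ PG := by rw [hPGdef]; positivity
  have hδG : HasMaj (BlockNorm.ofBlocks (unitTorusGeo L k M) (liftBlk (blockOf n M) ι)) (BlockNorm.ofBlocks (unitTorusGeo L k M) (liftBlk (blockOf n M) ι)) (Matrix.mulVecLin (cGreen M n T a - cGreen M n (fun (_ : Fin (d + 1)) (_ : Tor (fine n M)) => (1 : Matrix ι ι ℝ)) a)) (fun y y' => PG * Real.exp (-((δ - 2 * s) * tdistT M y y'))) := by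
    rw [hPGdef]; exact hδG0
  have hPGle : PG ≤ PG0 * r := by
    have hex : Real.exp (δ - 2 * s + s) ≤ Real.exp δ := Real.exp_le_exp.mpr hr7
    have h11 : (n : ℝ) * (((d + 1 : ℕ) : ℝ) * ρ) ≤ ((d : ℝ) + 1) * (Cρ * r) := by
      calc (n : ℝ) * (((d + 1 : ℕ) : ℝ) * ρ) = ((d : ℝ) + 1) * ((n : ℝ) * ρ) := by push_cast; ring
        _ ≤ ((d : ℝ) + 1) * (Cρ * r) := mul_le_mul_of_nonneg_left hnρ hD
    have h12 : CD + P0 * r ≤ CD + P0 := add_le_add le_rfl (mul_le_of_le_one_right hP0 hr1)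
    have t1 : CG * ((n : ℝ) * (((d + 1 : ℕ) : ℝ) * ρ) * Real.exp δ) * c ≤ CG * (((d : ℝ) + 1) * (Cρ * r) * Real.exp δ) * c :=
      mul_le_mul_of_nonneg_right (mul_le_mul_of_nonneg_left (mul_le_mul_of_nonneg_right h11 (Real.exp_pos _).le) hCG) hc
    have h1 : CG * ((n : ℝ) * (((d + 1 : ℕ) : ℝ) * ρ) * Real.exp δ) * c * (CD + P0 * r) * c ≤ CG * (((d : ℝ) + 1) * (Cρ * r) * Real.exp δ) * c * (CD + P0) * c :=
      mul_le_mul_of_nonneg_right (mul_le_mul t1 h12 (by positivity) (by positivity)) hc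
    have t2 : (n : ℝ) * ρ * Real.exp (δ - 2 * s + s) ≤ Cρ * r * Real.exp δ := mul_le_mul hnρ hex (Real.exp_pos _).le (by positivity)
    have h2 : CA * ((n : ℝ) * ρ * Real.exp (δ - 2 * s + s) * (2 * A0) * c) * c ≤ CA * (Cρ * r * Real.exp δ * (2 * A0) * c) * c :=
      mul_le_mul_of_nonneg_right (mul_le_mul_of_nonneg_left (mul_le_mul_of_nonneg_right (mul_le_mul_of_nonneg_right t2 (by positivity)) hc) hCA) hc
    have h30 : σ * ((1 + σ) * (2 * A0)) ≤ Cσ * r * (2 * (2 * A0)) := by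
      calc σ * ((1 + σ) * (2 * A0)) ≤ (Cσ * r) * (2 * (2 * A0)) := mul_le_mul hσle (mul_le_mul_of_nonneg_right hτ2 (by positivity)) (by positivity) (by positivity)
        _ = Cσ * r * (2 * (2 * A0)) := by ring
    have h3 : |a| * (CG * (((n : ℝ) ^ (d + 1))⁻¹ * σ * ((1 + σ) * (2 * A0))) * c) ≤ α * (CG * (Cσ * r * (2 * (2 * A0))) * c) := by
      calc |a| * (CG * (((n : ℝ) ^ (d + 1))⁻¹ * σ * ((1 + σ) * (2 * A0))) * c) = (|a| * ((n : ℝ) ^ (d + 1))⁻¹) * (CG * (σ * ((1 + σ) * (2 * A0))) * c) := by ring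
        _ ≤ α * (CG * (Cσ * r * (2 * (2 * A0))) * c) :=
            mul_le_mul haα (mul_le_mul_of_nonneg_right (mul_le_mul_of_nonneg_left h30 hCG) hc) (by positivity) hα
    have h40 : σ * (2 * A0) ≤ Cσ * r * (2 * A0) := mul_le_mul_of_nonneg_right hσle (by positivity)
    have h4 : |a| * (CG * (((n : ℝ) ^ (d + 1))⁻¹ * 1 * (σ * (2 * A0))) * c) ≤ α * (CG * (Cσ * r * (2 * A0)) * c) := by
      calc |a| * (CG * (((n : ℝ) ^ (d + 1))⁻¹ * 1 * (σ * (2 * A0))) * c) = (|a| * ((n : ℝ) ^ (d + 1))⁻¹) * (CG * (σ * (2 * A0)) * c) := by ring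
        _ ≤ α * (CG * (Cσ * r * (2 * A0)) * c) := mul_le_mul haα (mul_le_mul_of_nonneg_right (mul_le_mul_of_nonneg_left h40 hCG) hc) (by positivity) hα
    calc PG = _ := hPGdef
      _ ≤ CG * (((d : ℝ) + 1) * (Cρ * r) * Real.exp δ) * c * (CD + P0) * c + CA * (Cρ * r * Real.exp δ * (2 * A0) * c) * c +
          α * (CG * (Cσ * r * (2 * (2 * A0))) * c) + α * (CG * (Cσ * r * (2 * A0)) * c) := add_le_add (add_le_add (add_le_add h1 h2) h3) h4
      _ = PG0 * r := by rw [hPG0def]; unfold cPG0; rw [← hA0def]; ring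
  -- STEP 3: the common rate `δ′ = δ − 2s`, the common constants `C_M`, and the minimizer rows
  have hCGle : CG ≤ CM := by rw [hCM]; linarith only [hA0]
  have h2A0le : 2 * A0 ≤ CM := by rw [hCM]; linarith only [hCG]
  have hG1' : HasMaj (BlockNorm.ofBlocks (unitTorusGeo L k M) (liftBlk (blockOf n M) ι)) (BlockNorm.ofBlocks (unitTorusGeo L k M) (liftBlk (blockOf n M) ι)) (Matrix.mulVecLin (cGreen M n (fun (_ : Fin (d + 1)) (_ : Tor (fine n M)) => (1 : Matrix ι ι ℝ)) a)) (fun y y' => CM * Real.exp (-((δ - 2 * s) * tdistT M y y'))) :=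
    (hG1.of_rate_le hd hCG hr4).mono fun y y' => mul_le_mul_of_nonneg_right hCGle (Real.exp_nonneg _)
  have hGT' : HasMaj (BlockNorm.ofBlocks (unitTorusGeo L k M) (liftBlk (blockOf n M) ι)) (BlockNorm.ofBlocks (unitTorusGeo L k M) (liftBlk (blockOf n M) ι)) (Matrix.mulVecLin (cGreen M n T a)) (fun y y' => CM * Real.exp (-((δ - 2 * s) * tdistT M y y'))) :=
    hGT.mono fun y y' => mul_le_mul_of_nonneg_right h2A0le (Real.exp_nonneg _)
  have hMT := hasMaj_cM_of M n L k hCM0 hτ0 hτc hGT'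
  have hM1 := hasMaj_cM_of M n L k (T := (fun (_ : Fin (d + 1)) (_ : Tor (fine n M)) => (1 : Matrix ι ι ℝ))) hCM0 zero_le_one (stair_one_cols M n) hG1'
  have hδM := hasMaj_cM_sub_of M n L k hCM0 hPG hτ0 hσ0 hτc hσc hG1' hδG
  -- STEP 4 (n15-c∕214 + 216 §2): `S(T) − S(1)` and `S(T)⁻¹`
  have hδS := hasMaj_cSop_sub_of M n L k hCM0 hPG hτ0 hσ0 hs hr3 hrow hMT hM1 hδM
  have hBle : Fintype.card ι * c * CM * ((1 + σ) + 1) * (PG * (1 + σ) + CM * σ) ≤ B0 * r := by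
    have h1 : (1 + σ) + 1 ≤ 3 := by linarith only [hσ1]
    have h21 : PG * (1 + σ) ≤ PG0 * r * 2 := mul_le_mul hPGle hτ2 hτ0 (by positivity)
    have h22 : CM * σ ≤ CM * (Cσ * r) := mul_le_mul_of_nonneg_left hσle hCM0
    have h2 : PG * (1 + σ) + CM * σ ≤ (2 * PG0 + CM * Cσ) * r := by linarith only [h21, h22, show PG0 * r * 2 + CM * (Cσ * r) = (2 * PG0 + CM * Cσ) * r by ring]
    calc _ ≤ Fintype.card ι * c * CM * 3 * ((2 * PG0 + CM * Cσ) * r) := mul_le_mul (mul_le_mul_of_nonneg_left h1 (by positivity)) h2 (by positivity) (by positivity)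
      _ = B0 * r := by rw [hB0eq]; ring
  have hqS' : CS * (Fintype.card ι * c * CM * ((1 + σ) + 1) * (PG * (1 + σ) + CM * σ)) * c * c ≤ 1 / 2 := by
    have : CS * (Fintype.card ι * c * CM * ((1 + σ) + 1) * (PG * (1 + σ) + CM * σ)) * c * c ≤ CS * (B0 * r) * c * c :=
      mul_le_mul_of_nonneg_right (mul_le_mul_of_nonneg_right (mul_le_mul_of_nonneg_left hBle hCS) hc) hc
    exact this.trans (by linarith only [hq2, show CS * (B0 * r) * c * c = CS * B0 * c * c * r by ring])
  have hqS : CS * (Fintype.card ι * c * CM * ((1 + σ) + 1) * (PG * (1 + σ) + CM * σ)) * c * c < 1 := by linarith only [hqS']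
  have hS1' := hS1.of_rate_le hd (by positivity) hr4
  have hST0 := hasMaj_cSop_inv_of_flat M n L k hT ha (δ₁ := δ - 2 * s) hs hr13 hrow hc hCS (by positivity) hS1' hδS hqS
  have hinvS : (1 - CS * (Fintype.card ι * c * CM * ((1 + σ) + 1) * (PG * (1 + σ) + CM * σ)) * c * c)⁻¹ ≤ 2 := by
    calc _ ≤ (1 / 2 : ℝ)⁻¹ := inv_anti₀ (by norm_num) (by linarith only [hqS'])
      _ = 2 := by norm_num
  -- STEP 5 (n15-c∕214): everything at `δ″ = 3δ/4 ≤ δ − 4s`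
  have hST : HasMaj (BlockNorm.ofBlocks (unitTorusGeo L k M) (liftBlk (fun y : Tor M => y) ι)) (BlockNorm.ofBlocks (unitTorusGeo L k M) (liftBlk (fun y : Tor M => y) ι)) (Matrix.mulVecLin (cSop M n T a)⁻¹) (fun y y' => (2 * CS) * (n : ℝ) ^ (d + 1) * Real.exp (-((3 * δ / 4) * tdistT M y y'))) := by
    refine (hST0.mono fun y y' => mul_le_mul_of_nonneg_right ?_ (Real.exp_nonneg _)).of_rate_le hd (by positivity) hr8
    calc CS * (n : ℝ) ^ (d + 1) * (1 - CS * (Fintype.card ι * c * CM * ((1 + σ) + 1) * (PG * (1 + σ) + CM * σ)) * c * c)⁻¹ ≤ CS * (n : ℝ) ^ (d + 1) * 2 :=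
          mul_le_mul_of_nonneg_left hinvS (by positivity)
      _ = (2 * CS) * (n : ℝ) ^ (d + 1) := by ring
  exact hST

end Main

end Summit.QuantumFields.YangMills.BalabanUVNodes.N15.CovLandau

end
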